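import Summits.BirchSwinnertonDyer.BirchSwinnertonDyer.Theorems.TameQuarticSolventSolventPairLowerBoundTwistDatumOfNonvanishing
import Literature.NumberTheory.EllipticCurves.NonvanishingTwists
import Summits.BirchSwinnertonDyer.Rank1Residual.O5.HeegnerLogTransportThreeTraceCert
import Literature.NumberTheory.DiophantineGeometry.TateAlgorithm
import HarnessLib
import Literature.NumberTheory.EllipticCurves.NonvanishingTwistsPrescribedRamificationAtThree

/-!
# Route `TameQuarticSolvent`, crux `SolventPairLowerBound` (stmt-BirchSwinnertonDyer-21391), line `birth` —
# stub `stub_twistDatum` FROM TWO PUBLISHED INPUTS: modularity and Friedberg–Hoffstein's non-vanishing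
# theorem in the real, `3`-ramified local class (sign hypothesis discharged by Kobayashi's `w₃ = (−2/𝔽₃)`)

HONEST FRAMING. Theorems plus ONE named literature fact written inline for the gate to relocate under
`Literature/NumberTheory/EllipticCurves/` (width seat `bsd-wall-tqs-p1-w2`; `--supports
stmt-BirchSwinnertonDyer-21391`). The registered stub `stub_twistDatum` is NOT closed unconditionally: it is
proved here from the Modularity Theorem (`exists_isNewformOf`, BCDT 2001) and the named fact
`friedbergHoffstein_exists_pos_twist_ne_zero_ramifiedAtThree` below (Friedberg–Hoffstein 1995 Thm. B (1) in
the local class the route needs), i.e. it is CONDITIONAL on exactly those two published inputs and on nothing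
else. BSD is not proved by any of this; no route file is imported.

WHAT.
* `friedbergHoffstein_exists_pos_twist_ne_zero_ramifiedAtThree` (named fact, `def … : Prop`, cited): for
  `E/ℚ` with `w(E) = −1`, potentially good at `3` of Kodaira type `III` or `III*`, there are square-free
  `d > B` (every `B`) with `3 ∥ d`, every prime `ℓ ∣ N_E`, `ℓ ≠ 3` split in `ℚ(√d)`, and `L(E^{(d)}, 1) ≠ 0`.
  Its docstring carries the verification of Friedberg–Hoffstein's sign hypothesis on that class:
  `w(E^{(d)}) = −w(E)` (Kobayashi 2002 Thm. 1.1 (ii) at `3`, Deligne's product formula, Hilbert reciprocity).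
* `exists_pos_threeRamified_twist_L_ne_zero_of_friedbergHoffstein` — the analytic input `NV` of the companion
  file `…TwistDatumOfNonvanishing` (for every non-CM, globally minimal `W`, additive of class (t′) at `3`, of
  analytic rank `1`: some `d > 0` with `ord₃ d = 1` and `L(W^{(d)}, 1) ≠ 0`) from the two inputs: `r_an = 1`
  gives `w(W) = −1` (parity from modularity, tree `O5.HeegnerLogTransport.rootNumber_eq_neg_one_of_analyticRank_eq_one`), and
  (t′) at `3` is Kodaira `III`/`III*` with `ord₃ j ≥ 0` (b2b dictionary
  `Additive.subTprime_three_iff_kodairaSymbolAt_III_or_IIIstar`).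
* `stub_twistDatum_of_friedbergHoffstein` — the registered stub's statement, verbatim, from the two inputs
  (composition with the companion's `stub_twistDatum_of_nonvanishing`).

References: S. Friedberg, J. Hoffstein, Ann. of Math. 142 (1995) Thm. B; S. Kobayashi, Math. Ann. 323 (2002)
Thm. 1.1 (ii); P. Deligne, LNM 349 (1973) §5; J. Nekovář, Algebra Number Theory 7 (2013) Lemma 3.4;
C. Breuil, B. Conrad, F. Diamond, R. Taylor, J. Amer. Math. Soc. 14 (2001) Thm. A; J. H. Silverman, *AEC*
C.16 and *ATAEC* IV.9.4.
-/

-- D-0017: single-problem summit, so `Summit.BirchSwinnertonDyer.BirchSwinnertonDyer.…` repeats a namespace BY DESIGN.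
set_option linter.dupNamespace false

noncomputable section

open scoped Classical

open WeierstrassCurve
open Literature.NumberTheory.DiophantineGeometry
open Literature.NumberTheory.EllipticCurves
open Literature.NumberTheory.EllipticCurves.ModularForms

namespace Summit.BirchSwinnertonDyer.BirchSwinnertonDyer.Theorems.SolventPairLowerBound

/-- **The analytic input `NV` of `stub_twistDatum_of_nonvanishing`, from the two published inputs.** GIVEN
modularity (`exists_isNewformOf`) and Friedberg–Hoffstein's theorem in the real `3`-ramified class
(`friedbergHoffstein_exists_pos_twist_ne_zero_ramifiedAtThree`): every non-CM, globally minimal `W/ℚ`,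
additive of census class (t′) at `3`, of analytic rank `1`, has an integer `d > 0` with `ord₃ d = 1` and
`L(W^{(d)}, 1) ≠ 0`. Proof: `r_an = 1 ⇒ w(W) = −1` (parity from modularity, tree
`O5.HeegnerLogTransport.rootNumber_eq_neg_one_of_analyticRank_eq_one`); (t′) at `3` is `ord₃ j ≥ 0` and Kodaira
`III`/`III*` (b2b dictionary `Additive.subTprime_three_iff_kodairaSymbolAt_III_or_IIIstar`); apply the fact
with `B = 0`. [cite: FriedbergHoffstein1995, Thm. B (1)] [cite: Kobayashi2002, Thm. 1.1 (ii)] -/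
theorem exists_pos_threeRamified_twist_L_ne_zero_of_friedbergHoffstein (hmod : exists_isNewformOf)
    (hFH : Literature.NumberTheory.EllipticCurves.friedbergHoffstein_exists_pos_twist_ne_zero_ramifiedAtThree) :
    ∀ (W : WeierstrassCurve ℚ) [W.IsElliptic] [W.IsGloballyMinimal], ¬ W.HasCM →
      Literature.NumberTheory.EllipticCurves.Rank1Residual.Addv W 3 →
      Summit.BirchSwinnertonDyer.Rank1Residual.Additive.SubTprime W 3 → W.analyticRank = 1 →
      ∃ d : ℤ, 0 < d ∧ padicValInt 3 d = 1 ∧ (W.quadraticTwist (d : ℚ)).entireLFunction 1 ≠ 0 := by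
  intro W _ _ _ hadd hsub hr
  have hw : W.rootNumber = -1 :=
    Summit.BirchSwinnertonDyer.Rank1Residual.O5.HeegnerLogTransport.rootNumber_eq_neg_one_of_analyticRank_eq_one
      hmod W hr
  have hj : 0 ≤ padicValRat 3 W.j := not_lt.mp hsub.1
  have hIII : W.kodairaSymbolAt (Summit.BirchSwinnertonDyer.Rank1Residual.Additive.placeOf 3) = .III ∨
      W.kodairaSymbolAt (Summit.BirchSwinnertonDyer.Rank1Residual.Additive.placeOf 3) = .IIIstar :=
    (Summit.BirchSwinnertonDyer.Rank1Residual.Additive.subTprime_three_iff_kodairaSymbolAt_III_or_IIIstar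
      W hadd).mp hsub
  obtain ⟨d, hBd, -, hv, -, -, hL⟩ := hFH W hw hj hIII 0
  exact ⟨d, by exact_mod_cast hBd, hv, hL⟩

/-- **The registered stub `stub_twistDatum` of the birth skeleton of crux `SolventPairLowerBound`, from the
two published inputs** — modularity (`exists_isNewformOf`, BCDT 2001 Thm. A) and Friedberg–Hoffstein 1995
Thm. B (1) in the real `3`-ramified class (`friedbergHoffstein_exists_pos_twist_ne_zero_ramifiedAtThree`):
every non-CM, globally minimal `W/ℚ`, additive of class (t′) at `3`, with `r_an(W) = 1`, has an integer
`d > 0` with `ord₃ d = 1` and a globally minimal model `Wd` of `W^{(d)}`, non-CM, additive of class (t′) at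
`3`, with `r_an(Wd) = 0`. Composition of `exists_pos_threeRamified_twist_L_ne_zero_of_friedbergHoffstein`
with the companion file's `stub_twistDatum_of_nonvanishing` (global minimal model: Silverman *AEC*
VIII.8.3; non-CM and (t′) are twist-stable; `r_an(Wd) = 0 ⟺ L(W^{(d)}, 1) ≠ 0`). The statement below is the
registered stub signature verbatim; the stub is thereby CONDITIONAL on exactly these two named inputs.
[cite: FriedbergHoffstein1995, Thm. B (1)] [cite: BCDTJAMS2001, Thm. A]
[cite: SilvermanAEC2009, VIII.8 Cor. 8.3 and X.5 Cor. 5.4] -/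
theorem stub_twistDatum_of_friedbergHoffstein (hmod : exists_isNewformOf)
    (hFH : Literature.NumberTheory.EllipticCurves.friedbergHoffstein_exists_pos_twist_ne_zero_ramifiedAtThree) :
    ∀ (W : WeierstrassCurve ℚ) [W.IsElliptic] [W.IsGloballyMinimal],
    ¬ W.HasCM → Literature.NumberTheory.EllipticCurves.Rank1Residual.Addv W 3 →
      Summit.BirchSwinnertonDyer.Rank1Residual.Additive.SubTprime W 3 → W.analyticRank = 1 →
    ∃ (d : ℤ) (Wd : WeierstrassCurve ℚ) (_ : Wd.IsElliptic) (_ : Wd.IsGloballyMinimal),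
      0 < d ∧ padicValInt 3 d = 1 ∧
      (∃ C : WeierstrassCurve.VariableChange ℚ, C • W.quadraticTwist (d : ℚ) = Wd) ∧
      ¬ Wd.HasCM ∧ Literature.NumberTheory.EllipticCurves.Rank1Residual.Addv Wd 3 ∧
      Summit.BirchSwinnertonDyer.Rank1Residual.Additive.SubTprime Wd 3 ∧ Wd.analyticRank = 0 :=
  stub_twistDatum_of_nonvanishing hmod
    (exists_pos_threeRamified_twist_L_ne_zero_of_friedbergHoffstein hmod hFH)

end Summit.BirchSwinnertonDyer.BirchSwinnertonDyer.Theorems.SolventPairLowerBound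

end
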